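import Mathlib
import Literature.MathematicalPhysics.MHD.MercierIndicialEquation
import Literature.MathematicalPhysics.MHD.BallooningCoefficientComparison
import HarnessLib

/-!
# Ventures/FusionMHD — Models/BallooningMercierTail.lean: the GENERAL-GEOMETRY far-field («tail») certificate of the
# one-surface ballooning equation is a Mercier–Picone phase — the optimal constant `G*`, the tail phase
# `r = (G* − g₀) l̂ + c`, its EXACT Riccati residual `ρ̄ + E`, and `L·ρ̄ = (∮∂Q/∂ψ)²(4 D_M − 1)/(4∮dl/f₀)` with `D_M`
# the contour form (12.81); energy domination on the far field (Freidberg, *Ideal MHD* (2014) §12.5.3 (12.71)–(12.83);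
# Hartman, *ODE* (2002) XI §7 Thm 7.2 + Remark)

HONEST FRAMING (LADDER-GRIDFUSION three columns; fusion WATCH, DIRECTOR RULING 70 (7); FILING WORD director-gridfusion
g12 HOME INBOX 2026-08-28T21:33:22Z «YES-DEFERRED, same shape as I4582» + the substitution line HOME INBOX l.4716: ONE proved-
identity file under the FusionMHD tree, gate-first, after the Q4 CS29 set is 12/12 ACCEPTED; 0 kit; no ★ row; no `s–α`
content).  Written by gridfusion-model-7 (g12), 2026-08-28, as the Lean image of HOME/models/model-7/g12/F3-WATCH-NOTE-4.md §1.

WHAT IS HERE (everything PROVED; 0 named facts; nothing restated — the secular split (12.71), the circuit integrals and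
the contour form `contourD` (12.81) are lit-3's `Literature/MathematicalPhysics/MHD/MercierIndicialEquation.lean`, the
Riccati residual / energy-domination predicate and the Picone sufficiency theorem are lit-4's
`BallooningCoefficientComparison.lean`, all BY IMPORT):
* §1 (circuit level, on `Mercier.CircuitData`): the constant `Gstar = (∮g₀dl/f₀ − ½∮∂Q/∂ψ dl)/∮dl/f₀` — Freidberg's
  integration constant `G₀` of (12.77) at the double-root exponent `ν = −1/2` (`Gstar_eq_G0`) — and the circuit
  integral of the pointwise residual `ρ_G = g₁ + (G − g₀)∂Q/∂ψ + (G − g₀)²/f₀` of a linear phase: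
  ★ `meanResidualInt_eq` (it is the convex quadratic `∮g₁ + G∮∂Q/∂ψ − ∮g₀∂Q/∂ψ + G²∮1/f₀ − 2G∮g₀/f₀ + ∮g₀²/f₀`),
  ★★ `meanResidualInt_Gstar` — AT `G*` IT EQUALS `(∮∂Q/∂ψ)²(4·contourD − 1)/(4∮dl/f₀)`, i.e. it is NEGATIVE EXACTLY WHEN
  THE SURFACE IS MERCIER-STABLE (`meanResidualInt_Gstar_neg_iff`: `… < 0 ↔ MercierStable contourD` for `∮dl/f₀ > 0`), and
  `G*` is optimal (`meanResidualInt_Gstar_le`).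
* §2 (pointwise, abstract functions of the arc length `l`): the secular coefficients `P = f₀l̂² + f₁`, `Q = g₀′l̂ + g₁` of
  (12.71), the TAIL PHASE `r = (G − g₀)l̂ + c` and its derivative, and ★★ `riccatiResidual_tailPhase`: whenever
  `l̂′ = ∂Q/∂ψ`, `g₀′` is the derivative of `g₀` and `c′ = −(ρ_G − ρ̄)`, the Riccati residual of lit-4's
  `Ballooning.FieldLine.riccatiResidual` is IDENTICALLY `ρ̄ + E` with the explicit remainder
  `E = (2f₀(G − g₀)c l̂ + f₀c² − (G − g₀)²f₁)/(f₀(f₀l̂² + f₁))` (which is `O(1/l̂)`): the secular oscillatory drive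
  `g₀′l̂` is absorbed exactly.
* §3 ★★ `energyDominatesOn_tailPhase`: on any set `S` where the data are continuous, `f₀l̂² + f₁ > 0` and `ρ̄ + E ≤ 0`, the
  tail phase DOMINATES THE ENERGY (lit-4's `energyDominatesOn_of_riccati`), hence (`not_unstableWitness_tailPhase`) no
  instability witness of the secular equation has its window inside `S` — the far-field piece that lit-4's
  `forall_not_unstableWitness_of_three_pieces` glues to a core certificate; §3b ★ `remainderE_le_of_bounds` /
  `tail_residual_nonpos_of_bounds`: `E ≤ 2A_bC_b/(mT) + C_b²/(mT²)` from four sup-norm registers of one circuit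
  (`f₀ ≥ m`, `f₁ ≥ 0`, `|G − g₀| ≤ A_b`, `|c| ≤ C_b`) beyond `|l̂| ≥ T`, so the far field is certified by registers plus
  the Mercier margin.  §4 `unstableWitness_const_mul_iff`: witnesses
  of `(n²P, n²Q)` (the printed coefficients by `energyDensity_eq_secular`) and of `(P, Q)` coincide for `n ≠ 0`.
THREE COLUMNS.  CERTIFIED (kernel, this file): exact identities and a sufficiency theorem about the MODEL equation
(12.71)/(12.40) of ONE flux surface; they turn «Mercier-stable with margin» plus finitely many interval inequalities on one
poloidal circuit into «no ballooning witness beyond `T` turns».  VALIDATED (juxtaposed, never merged; NOTE-4 §2): on the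
PCF ITER-like / NSTX-like and CF ITER-like model surfaces the leading-order phase has residual ≤ 0 beyond `T* = 0.4 … 30`
turns.  MODELLED: ideal MHD, high-`n` ballooning ordering, one surface of a MODEL equilibrium, fixed field-line origin;
nothing about a device.  NOT here: the choice of `T` for a given surface (a Bench-file interval computation), the core
certificate on `[−T, T]`, the oscillation converse (`D_M > 1/4`), anything 2-D (the ballooning representation itself).
Sources: Freidberg 2014 §12.5.3 eqs. (12.71)–(12.83) [Freidberg2014] (book:freidbergnd-ideal-mhd p0481–p0482, read
2026-08-28); Hartman 2002 Ch. XI §7 Thm 7.2 + Remark [Hartman2002] (p0345, read 2026-08-28).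
-/

noncomputable section

open Real Set MeasureTheory intervalIntegral

namespace Summit.Ventures.FusionMHD.Models.MercierTail

open Literature.MathematicalPhysics.MHD Literature.MathematicalPhysics.MHD.Mercier
  Literature.MathematicalPhysics.MHD.Ballooning

/-! ## §1 Circuit level: the optimal constant `G*` and the mean residual of a linear phase -/

namespace Circuit

variable (c : CircuitData)

/-- THE OPTIMAL CONSTANT of the tail phase, `G* = (∮g₀ dl/f₀ − ½ ∮∂Q/∂ψ dl)/∮dl/f₀` — Freidberg's `G₀` (12.77) at the
double-root indicial exponent `ν = −1/2` (`Gstar_eq_G0`). MODELLED: circuit data of one surface of a model equilibrium.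
[cite: Freidberg2014, §12.5.3 eq. (12.77)] -/
def Gstar : ℝ := (c.intG0F0 - c.intQψ / 2) / c.intInvF0

/-- `G*` is the printed integration constant `G₀(ν)` of (12.77) at `ν = −1/2`. [cite: Freidberg2014, §12.5.3 eq. (12.77)] -/
theorem Gstar_eq_G0 : Gstar c = c.G0 (-1 / 2) := by
  unfold Gstar CircuitData.G0
  ring

/-- The pointwise residual density of the linear phase with constant `G`:
`ρ_G(l) = g₁ + (G − g₀)∂Q/∂ψ + (G − g₀)²/f₀` (the `l̂`-free part of the Riccati residual, §2). [folklore] -/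
def rho (G : ℝ) (l : ℝ) : ℝ := c.g1 l + (G - c.g0 l) * c.Qψ l + (G - c.g0 l) ^ 2 / c.f0 l

/-- Its circuit integral `L·ρ̄(G) = ∮ ρ_G dl`. [folklore] -/
def meanResidualInt (G : ℝ) : ℝ := ∫ l in (0:ℝ)..c.L, rho c G l

/-- ★ `∮ρ_G dl = ∮g₁ + G∮∂Q/∂ψ − ∮g₀∂Q/∂ψ + G²∮dl/f₀ − 2G∮g₀dl/f₀ + ∮g₀²dl/f₀` — a convex quadratic in `G` written
in the six circuit registers of `MercierIndicialEquation.lean` (five of which are those of (12.81)).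
[cite: Freidberg2014, §12.5.3 eq. (12.81)] -/
theorem meanResidualInt_eq (hc : c.Regular) (G : ℝ) :
    meanResidualInt c G
      = c.intG1 + G * c.intQψ - c.intG0Qψ + G ^ 2 * c.intInvF0 - 2 * G * c.intG0F0 + c.intG0SqF0 := by
  have hi1 : IntervalIntegrable (fun l => 1 / c.f0 l) volume 0 c.L :=
    (continuousOn_const.div hc.f0_cont hc.f0_ne).intervalIntegrable
  have hi2 : IntervalIntegrable (fun l => c.g0 l / c.f0 l) volume 0 c.L :=
    (hc.g0_cont.div hc.f0_cont hc.f0_ne).intervalIntegrable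
  have hi3 : IntervalIntegrable (fun l => c.Qψ l) volume 0 c.L := hc.Qψ_cont.intervalIntegrable
  have hi4 : IntervalIntegrable (fun l => c.g0 l ^ 2 / c.f0 l) volume 0 c.L :=
    ((hc.g0_cont.pow 2).div hc.f0_cont hc.f0_ne).intervalIntegrable
  have hi5 : IntervalIntegrable (fun l => c.g1 l) volume 0 c.L := hc.g1_cont.intervalIntegrable
  have hi6 : IntervalIntegrable (fun l => c.g0 l * c.Qψ l) volume 0 c.L :=
    (hc.g0_cont.mul hc.Qψ_cont).intervalIntegrable
  have hpt : EqOn (rho c G)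
      (fun l => ((c.g1 l + G * c.Qψ l - c.g0 l * c.Qψ l)
        + (G ^ 2 * (1 / c.f0 l) - 2 * G * (c.g0 l / c.f0 l) + c.g0 l ^ 2 / c.f0 l))) (uIcc 0 c.L) := by
    intro l hl
    have hf := hc.f0_ne l hl
    simp only [rho]
    field_simp
    ring
  unfold meanResidualInt
  rw [intervalIntegral.integral_congr hpt,
    intervalIntegral.integral_add ((hi5.add (hi3.const_mul _)).sub hi6)
      (((hi1.const_mul _).sub (hi2.const_mul _)).add hi4),
    intervalIntegral.integral_sub (hi5.add (hi3.const_mul _)) hi6,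
    intervalIntegral.integral_add hi5 (hi3.const_mul _),
    intervalIntegral.integral_add ((hi1.const_mul _).sub (hi2.const_mul _)) hi4,
    intervalIntegral.integral_sub (hi1.const_mul _) (hi2.const_mul _),
    intervalIntegral.integral_const_mul, intervalIntegral.integral_const_mul, intervalIntegral.integral_const_mul]
  change c.intG1 + G * c.intQψ - c.intG0Qψ + (G ^ 2 * c.intInvF0 - 2 * G * c.intG0F0 + c.intG0SqF0) = _
  ring

/-- ★★ AT THE OPTIMAL CONSTANT THE MEAN RESIDUAL IS THE MERCIER MARGIN:
`∮ρ_{G*} dl = (∮∂Q/∂ψ dl)²·(4 D_M − 1)/(4 ∮dl/f₀)` with `D_M = contourD` the contour form (12.81) verbatim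
(`∮dl/f₀ ≠ 0`, `∮∂Q/∂ψ dl ≠ 0`). [cite: Freidberg2014, §12.5.3 eq. (12.81)] -/
theorem meanResidualInt_Gstar (hc : c.Regular) (ha : c.intInvF0 ≠ 0) (hA : c.intQψ ≠ 0) :
    meanResidualInt c (Gstar c) = c.intQψ ^ 2 * (4 * c.contourD - 1) / (4 * c.intInvF0) := by
  rw [meanResidualInt_eq c hc, Gstar, CircuitData.contourD]
  field_simp
  ring

/-- `G*` minimises the mean residual among linear phases: `∮ρ_{G*} ≤ ∮ρ_G` for every `G` (`∮dl/f₀ > 0`). [folklore] -/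
theorem meanResidualInt_Gstar_le (hc : c.Regular) (ha : 0 < c.intInvF0) (G : ℝ) :
    meanResidualInt c (Gstar c) ≤ meanResidualInt c G := by
  rw [meanResidualInt_eq c hc, meanResidualInt_eq c hc, Gstar]
  have key : (c.intG1 + G * c.intQψ - c.intG0Qψ + G ^ 2 * c.intInvF0 - 2 * G * c.intG0F0 + c.intG0SqF0)
      - (c.intG1 + (c.intG0F0 - c.intQψ / 2) / c.intInvF0 * c.intQψ - c.intG0Qψ
          + ((c.intG0F0 - c.intQψ / 2) / c.intInvF0) ^ 2 * c.intInvF0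
          - 2 * ((c.intG0F0 - c.intQψ / 2) / c.intInvF0) * c.intG0F0 + c.intG0SqF0)
      = c.intInvF0 * (G - (c.intG0F0 - c.intQψ / 2) / c.intInvF0) ^ 2 := by
    field_simp
    ring
  nlinarith [key, mul_nonneg ha.le (sq_nonneg (G - (c.intG0F0 - c.intQψ / 2) / c.intInvF0))]

/-- ★★ THE SIGN: the optimal mean residual is negative IFF the surface is Mercier-stable, `D_M < 1/4`
(`Mercier.MercierStable`, (12.83)) — for `∮dl/f₀ > 0` and `∮∂Q/∂ψ dl ≠ 0` (i.e. `dq/dψ ≠ 0` by (12.70)).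
[cite: Freidberg2014, §12.5.3 eqs. (12.81)–(12.83)] -/
theorem meanResidualInt_Gstar_neg_iff (hc : c.Regular) (ha : 0 < c.intInvF0) (hA : c.intQψ ≠ 0) :
    meanResidualInt c (Gstar c) < 0 ↔ MercierStable c.contourD := by
  rw [meanResidualInt_Gstar c hc ha.ne' hA, MercierStable]
  have h4 : 0 < 4 * c.intInvF0 := by positivity
  have hQ : 0 < c.intQψ ^ 2 := by positivity
  rw [div_lt_iff₀ h4, zero_mul]
  constructor
  · intro h
    by_contra hge
    have hge' : 1 / 4 ≤ c.contourD := not_lt.mp hge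
    have : 0 ≤ c.intQψ ^ 2 * (4 * c.contourD - 1) := mul_nonneg hQ.le (by linarith)
    linarith
  · intro h
    have : 4 * c.contourD - 1 < 0 := by linarith
    exact mul_neg_of_pos_of_neg hQ this

end Circuit

/-! ## §2 Pointwise: the secular coefficients, the tail phase and its exact Riccati residual -/

/-- The secular line-bending coefficient of (12.71), `P(l) = f₀ l̂² + f₁` (`= (k_n² + k_t²)B_p/(n²B²)` by
`Mercier.LineData.bendingCoeff_eq_secular`). [cite: Freidberg2014, §12.5.3 eq. (12.71)] -/
def secP (f0 f1 lhat : ℝ → ℝ) (l : ℝ) : ℝ := f0 l * lhat l ^ 2 + f1 l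

/-- The secular drive of (12.71), `Q(l) = g₀′ l̂ + g₁` (`= driveCoeff/n²` by `Mercier.LineData.driveCoeff_eq_secular`). [cite: Freidberg2014, §12.5.3 eq. (12.71)] -/
def secQ (g0' g1 lhat : ℝ → ℝ) (l : ℝ) : ℝ := g0' l * lhat l + g1 l

/-- THE TAIL PHASE with constant `G` and periodic corrector `c`: `r(l) = (G − g₀(l))·l̂(l) + c(l)`. [folklore] -/
def tailPhase (G : ℝ) (g0 lhat c : ℝ → ℝ) (l : ℝ) : ℝ := (G - g0 l) * lhat l + c l

/-- Its derivative along the line, `r′ = −g₀′ l̂ + (G − g₀)∂Q/∂ψ + c′` (when `l̂′ = ∂Q/∂ψ`). [folklore] -/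
def tailPhaseDeriv (G : ℝ) (g0 g0' lhat Qψ c' : ℝ → ℝ) (l : ℝ) : ℝ :=
  -(g0' l) * lhat l + (G - g0 l) * Qψ l + c' l

/-- The pointwise residual density `ρ_G = g₁ + (G − g₀)∂Q/∂ψ + (G − g₀)²/f₀` (same expression as `Circuit.rho`). [folklore] -/
def rhoFun (G : ℝ) (f0 g0 g1 Qψ : ℝ → ℝ) (l : ℝ) : ℝ :=
  g1 l + (G - g0 l) * Qψ l + (G - g0 l) ^ 2 / f0 l

/-- THE EXPLICIT REMAINDER `E = (2f₀(G − g₀)c l̂ + f₀c² − (G − g₀)²f₁)/(f₀(f₀l̂² + f₁))`, which is `O(1/l̂)` for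
bounded periodic data. [folklore] -/
def remainderE (G : ℝ) (f0 f1 g0 lhat c : ℝ → ℝ) (l : ℝ) : ℝ :=
  (2 * f0 l * (G - g0 l) * c l * lhat l + f0 l * c l ^ 2 - (G - g0 l) ^ 2 * f1 l)
    / (f0 l * (f0 l * lhat l ^ 2 + f1 l))

/-- `Circuit.rho` is `rhoFun` of the circuit data. [folklore] -/
theorem rho_eq_rhoFun (c : CircuitData) (G l : ℝ) : Circuit.rho c G l = rhoFun G c.f0 c.g0 c.g1 c.Qψ l := rfl

/-- The tail phase is differentiable with the stated derivative wherever `g₀`, `l̂`, `c` are, with `l̂′ = ∂Q/∂ψ`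
(the fundamental theorem for `l̂ = ∫∂Q/∂ψ dl`). [folklore] -/
theorem hasDerivAt_tailPhase {G : ℝ} {g0 g0' lhat Qψ c c' : ℝ → ℝ} {l : ℝ}
    (hg0 : HasDerivAt g0 (g0' l) l) (hl : HasDerivAt lhat (Qψ l) l) (hcd : HasDerivAt c (c' l) l) :
    HasDerivAt (tailPhase G g0 lhat c) (tailPhaseDeriv G g0 g0' lhat Qψ c' l) l := by
  have h1 : HasDerivAt (fun x => (G - g0 x) * lhat x) ((0 - g0' l) * lhat l + (G - g0 l) * Qψ l) l :=
    (((hasDerivAt_const l G).sub hg0).mul hl)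
  have h2 := h1.add hcd
  refine h2.congr_deriv ?_
  unfold tailPhaseDeriv
  ring

/-- ★★ THE EXACT RICCATI RESIDUAL OF THE TAIL PHASE.  If the corrector's derivative is `c′ = −(ρ_G − ρ̄)` at the
point, then lit-4's residual `r′ + r²/P + Q` of `r = (G − g₀)l̂ + c` for the secular pair `(P, Q) = (f₀l̂² + f₁, g₀′l̂ + g₁)`
equals `ρ̄ + E(l)` — the secular oscillatory drive `g₀′ l̂` cancels identically (`f₀ ≠ 0`, `f₀l̂² + f₁ ≠ 0`).
[cite: Hartman2002, Ch. XI §7 Thm. 7.2] -/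
theorem riccatiResidual_tailPhase {G ρbar : ℝ} {f0 f1 g0 g0' g1 lhat Qψ c c' : ℝ → ℝ} {l : ℝ}
    (hf0 : f0 l ≠ 0) (hP : f0 l * lhat l ^ 2 + f1 l ≠ 0)
    (hc' : c' l = -(rhoFun G f0 g0 g1 Qψ l - ρbar)) :
    FieldLine.riccatiResidual (secP f0 f1 lhat) (secQ g0' g1 lhat) (tailPhase G g0 lhat c)
        (tailPhaseDeriv G g0 g0' lhat Qψ c') l
      = ρbar + remainderE G f0 f1 g0 lhat c l := by
  have hP' : lhat l ^ 2 * f0 l + f1 l ≠ 0 := by rw [mul_comm]; exact hP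
  unfold FieldLine.riccatiResidual secP secQ tailPhase tailPhaseDeriv remainderE
  rw [hc']
  unfold rhoFun
  rw [← sub_eq_zero]
  field_simp
  ring

/-! ## §3 Energy domination on the far field and the absence of witnesses there -/

/-- ★★ THE TAIL DOMINATES THE ENERGY where its residual is non-positive.  On a set `S` on which `f₀, f₁, g₀, g₀′, g₁, l̂,
∂Q/∂ψ, c′` are continuous (`c` need not be: only its derivative enters), `f₀ ≠ 0`, `P = f₀l̂² + f₁ > 0`, `g₀`/`l̂`/`c` have the stated derivatives with
`c′ = −(ρ_G − ρ̄)`, and `ρ̄ + E ≤ 0`, the tail phase dominates the energy of the secular equation on `S`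
(lit-4's `energyDominatesOn_of_riccati`, Hartman XI Thm 7.2 sufficiency). [cite: Hartman2002, Ch. XI §7 Thm. 7.2] -/
theorem energyDominatesOn_tailPhase {G ρbar : ℝ} {f0 f1 g0 g0' g1 lhat Qψ c c' : ℝ → ℝ} {S : Set ℝ}
    (hf0c : ContinuousOn f0 S) (hf1c : ContinuousOn f1 S) (hg0c : ContinuousOn g0 S) (hg0'c : ContinuousOn g0' S)
    (hg1c : ContinuousOn g1 S) (hlc : ContinuousOn lhat S) (hQc : ContinuousOn Qψ S)
    (hc'c : ContinuousOn c' S)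
    (hf0 : ∀ l ∈ S, f0 l ≠ 0) (hP : ∀ l ∈ S, 0 < f0 l * lhat l ^ 2 + f1 l)
    (hg0 : ∀ l ∈ S, HasDerivAt g0 (g0' l) l) (hl : ∀ l ∈ S, HasDerivAt lhat (Qψ l) l)
    (hcd : ∀ l ∈ S, HasDerivAt c (c' l) l) (hc' : ∀ l ∈ S, c' l = -(rhoFun G f0 g0 g1 Qψ l - ρbar))
    (hres : ∀ l ∈ S, ρbar + remainderE G f0 f1 g0 lhat c l ≤ 0) :
    FieldLine.EnergyDominatesOn (secP f0 f1 lhat) (secQ g0' g1 lhat) (tailPhase G g0 lhat c) S := by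
  refine FieldLine.energyDominatesOn_of_riccati (r' := tailPhaseDeriv G g0 g0' lhat Qψ c') ?_ ?_ ?_ ?_ ?_ ?_
  · exact (hf0c.mul (hlc.pow 2)).add hf1c
  · exact (hg0'c.mul hlc).add hg1c
  · intro l hlS; exact hP l hlS
  · intro l hlS; exact hasDerivAt_tailPhase (hg0 l hlS) (hl l hlS) (hcd l hlS)
  · exact ((hg0'c.neg.mul hlc).add ((continuousOn_const.sub hg0c).mul hQc)).add hc'c
  · intro l hlS
    rw [riccatiResidual_tailPhase (hf0 l hlS) (hP l hlS).ne' (hc' l hlS)]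
    exact hres l hlS

/-- ★ Consequently NO INSTABILITY WITNESS of the secular equation has its window inside such a far-field set `S`
(lit-4's `EnergyDominatesOn.not_unstableWitness`). [cite: Freidberg2014, §12.3 eq. (12.40)] -/
theorem not_unstableWitness_tailPhase {G ρbar : ℝ} {f0 f1 g0 g0' g1 lhat Qψ c c' : ℝ → ℝ} {S : Set ℝ}
    (hf0c : ContinuousOn f0 S) (hf1c : ContinuousOn f1 S) (hg0c : ContinuousOn g0 S) (hg0'c : ContinuousOn g0' S)
    (hg1c : ContinuousOn g1 S) (hlc : ContinuousOn lhat S) (hQc : ContinuousOn Qψ S)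
    (hc'c : ContinuousOn c' S)
    (hf0 : ∀ l ∈ S, f0 l ≠ 0) (hP : ∀ l ∈ S, 0 < f0 l * lhat l ^ 2 + f1 l)
    (hg0 : ∀ l ∈ S, HasDerivAt g0 (g0' l) l) (hl : ∀ l ∈ S, HasDerivAt lhat (Qψ l) l)
    (hcd : ∀ l ∈ S, HasDerivAt c (c' l) l) (hc' : ∀ l ∈ S, c' l = -(rhoFun G f0 g0 g1 Qψ l - ρbar))
    (hres : ∀ l ∈ S, ρbar + remainderE G f0 f1 g0 lhat c l ≤ 0)
    {a b : ℝ} (hI : Icc a b ⊆ S) (X X' : ℝ → ℝ) :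
    ¬ FieldLine.UnstableWitness (secP f0 f1 lhat) (secQ g0' g1 lhat) a b X X' :=
  (energyDominatesOn_tailPhase hf0c hf1c hg0c hg0'c hg1c hlc hQc hc'c hf0 hP hg0 hl hcd hc' hres).not_unstableWitness
    ((hf0c.mul (hlc.pow 2)).add hf1c) ((hg0'c.mul hlc).add hg1c) hP hI X X'


/-! ## §3b A uniform bound on the remainder beyond `|l̂| ≥ T` from sup-norm registers -/

/-- THE REMAINDER SPLIT: `E = 2(G − g₀)c l̂/D + c²/D − (G − g₀)²f₁/(f₀D)` with `D = f₀l̂² + f₁` (`f₀ ≠ 0`, `D ≠ 0`). [folklore] -/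
theorem remainderE_eq_three_terms {G : ℝ} {f0 f1 g0 lhat c : ℝ → ℝ} {l : ℝ} (hf0 : f0 l ≠ 0)
    (hD : f0 l * lhat l ^ 2 + f1 l ≠ 0) :
    remainderE G f0 f1 g0 lhat c l
      = 2 * (G - g0 l) * c l * lhat l / (f0 l * lhat l ^ 2 + f1 l)
        + c l ^ 2 / (f0 l * lhat l ^ 2 + f1 l)
        - (G - g0 l) ^ 2 * f1 l / (f0 l * (f0 l * lhat l ^ 2 + f1 l)) := by
  unfold remainderE
  field_simp

/-- ★ UNIFORM FAR-FIELD BOUND FROM FOUR REGISTERS: if on the panel `f₀ ≥ m > 0`, `f₁ ≥ 0`, `|G − g₀| ≤ A_b`, `|c| ≤ C_b`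
and `|l̂| ≥ T > 0`, then `E ≤ 2A_bC_b/(mT) + C_b²/(mT²)`.  Hence `ρ̄ + E ≤ 0` as soon as both terms are `≤ −ρ̄/2`
(`tail_residual_nonpos_of_bounds`): the tail certificate of a surface is ONE circuit of interval registers plus the
Mercier margin. [folklore] -/
theorem remainderE_le_of_bounds {G Ab Cb m T : ℝ} {f0 f1 g0 lhat c : ℝ → ℝ} {l : ℝ}
    (hm0 : 0 < m) (hT : 0 < T) (hm : m ≤ f0 l) (hf1 : 0 ≤ f1 l)
    (hA : |G - g0 l| ≤ Ab) (hc : |c l| ≤ Cb) (hl : T ≤ |lhat l|) :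
    remainderE G f0 f1 g0 lhat c l ≤ 2 * Ab * Cb / (m * T) + Cb ^ 2 / (m * T ^ 2) := by
  have hf : 0 < f0 l := lt_of_lt_of_le hm0 hm
  have hLabs : 0 < |lhat l| := lt_of_lt_of_le hT hl
  have hL0 : lhat l ≠ 0 := abs_pos.mp hLabs
  have hL2 : 0 < lhat l ^ 2 := by positivity
  have hAb : 0 ≤ Ab := le_trans (abs_nonneg _) hA
  have hCb : 0 ≤ Cb := le_trans (abs_nonneg _) hc
  have hfL : 0 < f0 l * lhat l ^ 2 := mul_pos hf hL2
  have hD : 0 < f0 l * lhat l ^ 2 + f1 l := by linarith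
  have hDge : f0 l * lhat l ^ 2 ≤ f0 l * lhat l ^ 2 + f1 l := by linarith
  rw [remainderE_eq_three_terms hf.ne' hD.ne']
  -- term 1
  have h1num : 2 * (G - g0 l) * c l * lhat l ≤ 2 * Ab * Cb * |lhat l| := by
    have habs : (G - g0 l) * c l * lhat l ≤ |G - g0 l| * |c l| * |lhat l| := by
      rw [← abs_mul, ← abs_mul]; exact le_abs_self _
    have hmono : |G - g0 l| * |c l| * |lhat l| ≤ Ab * Cb * |lhat l| := by
      gcongr
    linarith
  have h1 : 2 * (G - g0 l) * c l * lhat l / (f0 l * lhat l ^ 2 + f1 l) ≤ 2 * Ab * Cb / (m * T) := by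
    have step1 : 2 * (G - g0 l) * c l * lhat l / (f0 l * lhat l ^ 2 + f1 l)
        ≤ 2 * Ab * Cb * |lhat l| / (f0 l * lhat l ^ 2 + f1 l) :=
      div_le_div_of_nonneg_right h1num hD.le
    have step2 : 2 * Ab * Cb * |lhat l| / (f0 l * lhat l ^ 2 + f1 l)
        ≤ 2 * Ab * Cb * |lhat l| / (f0 l * lhat l ^ 2) :=
      div_le_div_of_nonneg_left (by positivity) hfL hDge
    have step3 : 2 * Ab * Cb * |lhat l| / (f0 l * lhat l ^ 2) = 2 * Ab * Cb / (f0 l * |lhat l|) := by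
      have : lhat l ^ 2 = |lhat l| * |lhat l| := by rw [← sq_abs]; ring
      rw [this]
      field_simp
    have step4 : 2 * Ab * Cb / (f0 l * |lhat l|) ≤ 2 * Ab * Cb / (m * T) :=
      div_le_div_of_nonneg_left (by positivity) (by positivity) (mul_le_mul hm hl hT.le hf.le)
    linarith [step3.le, step3.ge]
  -- term 2
  have h2 : c l ^ 2 / (f0 l * lhat l ^ 2 + f1 l) ≤ Cb ^ 2 / (m * T ^ 2) := by
    have hc2 : c l ^ 2 ≤ Cb ^ 2 := by
      have := sq_abs (c l); rw [← this]; exact pow_le_pow_left₀ (abs_nonneg _) hc 2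
    have step1 : c l ^ 2 / (f0 l * lhat l ^ 2 + f1 l) ≤ Cb ^ 2 / (f0 l * lhat l ^ 2 + f1 l) :=
      div_le_div_of_nonneg_right hc2 hD.le
    have step2 : Cb ^ 2 / (f0 l * lhat l ^ 2 + f1 l) ≤ Cb ^ 2 / (f0 l * lhat l ^ 2) :=
      div_le_div_of_nonneg_left (by positivity) hfL hDge
    have hT2 : T ^ 2 ≤ lhat l ^ 2 := by
      rw [← sq_abs (lhat l)]; exact pow_le_pow_left₀ hT.le hl 2
    have step3 : Cb ^ 2 / (f0 l * lhat l ^ 2) ≤ Cb ^ 2 / (m * T ^ 2) :=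
      div_le_div_of_nonneg_left (by positivity) (by positivity) (mul_le_mul hm hT2 (by positivity) hf.le)
    linarith
  -- term 3 is non-positive
  have h3 : 0 ≤ (G - g0 l) ^ 2 * f1 l / (f0 l * (f0 l * lhat l ^ 2 + f1 l)) := by positivity
  linarith

/-- ★ … so with the Mercier margin `δ = −ρ̄ > 0` the residual is `≤ 0` on the panel as soon as
`2A_bC_b/(mT) ≤ δ/2` and `C_b²/(mT²) ≤ δ/2`. [folklore] -/
theorem tail_residual_nonpos_of_bounds {G ρbar Ab Cb m T : ℝ} {f0 f1 g0 lhat c : ℝ → ℝ} {l : ℝ}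
    (hm0 : 0 < m) (hT : 0 < T) (hm : m ≤ f0 l) (hf1 : 0 ≤ f1 l)
    (hA : |G - g0 l| ≤ Ab) (hc : |c l| ≤ Cb) (hl : T ≤ |lhat l|)
    (h1 : 2 * Ab * Cb / (m * T) ≤ -ρbar / 2) (h2 : Cb ^ 2 / (m * T ^ 2) ≤ -ρbar / 2) :
    ρbar + remainderE G f0 f1 g0 lhat c l ≤ 0 := by
  have := remainderE_le_of_bounds (G := G) (f0 := f0) (f1 := f1) (g0 := g0) (lhat := lhat) (c := c)
    hm0 hT hm hf1 hA hc hl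
  linarith

/-! ## §4 Scaling by `n²`: witnesses of the printed coefficients are witnesses of the secular pair -/

/-- The field-line energy is homogeneous in a constant coefficient factor: `W[(kP, kQ)] = k·W[(P, Q)]`. [folklore] -/
theorem energy_const_mul (k : ℝ) (P Q X X' : ℝ → ℝ) (a b : ℝ) :
    FieldLine.energy (fun l => k * P l) (fun l => k * Q l) X X' a b = k * FieldLine.energy P Q X X' a b := by
  unfold FieldLine.energy
  rw [← intervalIntegral.integral_const_mul]
  congr 1
  funext l
  unfold FieldLine.energyDensity
  ring

/-- For a POSITIVE constant factor (the `n²` of (12.40) = `n²`·(12.71), `n ≠ 0`, by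
`Mercier.LineData.energyDensity_eq_secular`) the instability witnesses of `(kP, kQ)` and of `(P, Q)` are the same.
[cite: Freidberg2014, §12.5.3 eq. (12.71)] -/
theorem unstableWitness_const_mul_iff {k : ℝ} (hk : 0 < k) (P Q : ℝ → ℝ) (a b : ℝ) (X X' : ℝ → ℝ) :
    FieldLine.UnstableWitness (fun l => k * P l) (fun l => k * Q l) a b X X' ↔ FieldLine.UnstableWitness P Q a b X X' := by
  unfold FieldLine.UnstableWitness
  rw [energy_const_mul]
  constructor
  · rintro ⟨hab, hX, ha, hb, hneg⟩
    refine ⟨hab, hX, ha, hb, ?_⟩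
    by_contra hnn
    have : 0 ≤ k * FieldLine.energy P Q X X' a b := mul_nonneg hk.le (not_lt.mp hnn)
    linarith
  · rintro ⟨hab, hX, ha, hb, hneg⟩
    exact ⟨hab, hX, ha, hb, mul_neg_of_pos_of_neg hk hneg⟩

end Summit.Ventures.FusionMHD.Models.MercierTail

end
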